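import Mathlib.MeasureTheory.Measure.Tilted
import Mathlib.MeasureTheory.Constructions.Pi
import Mathlib.Logic.Function.DependsOn
import Literature.MathematicalPhysics.QuantumFieldTheory.ConstructiveQFTWave0
import Literature.MathematicalPhysics.QuantumLattice.GaugeGroups
import Literature.Probability.LatticeModels.LatticeGraph
import Literature.Probability.LatticeModels.ThermodynamicLimit
import Literature.Probability.LatticeModels.GibbsSpecification
import HarnessLib

-- provenance: harness21/H21/H21/Prelude/QLatticeAQFT/LatticeGaugeDLR.lean @ dfb519f (interim HEAD d8f2665); M5 mechanical rewrite
/-!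
# Lattice gauge theory on the infinite lattice `ℤ^d`: cylinder observables, infinite-volume
limits along tori, DLR states, free energy

Trunk G13 (`QLatticeAQFT`), prelude item A9 `LatticeGaugeDLR` (notion `lattice_gauge_config`;
outline decision A-D3). Families served: `constructive-qft` (S14, S16, S17, S26, S28 need
infinite-volume lattice gauge states), and the continuum-limit items A10/A11.

## Content

* Bookkeeping on `ℤ^d` (sharing G02's `StatMech.Site d = Fin d → ℤ`): positively oriented edges
  `ZdEdge d := Site d × Fin d` (`(x, i)` is the edge `x → x + eᵢ`), plaquettes `ZdPlaquette d`
  (`(x, ⟨(i, j), i < j⟩)`), configurations `LGConfig d G := ZdEdge d → G`, plaquette holonomies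
  `plaquetteHolonomyZd`, `plaquetteEdges`, `plaquettesTouching`, gauge transformations
  `gaugeTransformZd` / `IsZdGaugeInvariant`, lattice translations `edgeShift` / `configShift` /
  `IsZdTranslationInvariant` (Seiler LNP 159 Ch. 1; Chatterjee arXiv:1803.01950 §2).
* Cylinder (local) observables `IsCylinder F S :↔ DependsOn F ↑S` (Mathlib `DependsOn`),
  `IsLocalObservable`.
* The comparison with Wave 0's finite-volume torus theory
  (`Literature.Statements.ConstructiveQFT.Wave0`): `torusEdge L : ZdEdge d → ConstructiveQFT.Edge d L`
  (reduction mod `L` via G02 `Torus.proj`), `torusLift`, `toTorusObservable`.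
* Infinite-volume limits **along tori** (outline A-D3): `IsInfiniteVolumeLimitAlong`,
  `IsInfiniteVolumeLimit`, the set `infiniteVolumeLimitPoints ρ β` of subsequential limits of the
  torus Wilson states `μ_{Λ_L, β}` as `L → ∞`, `infiniteVolumeLimitPoints_nonempty` (compactness
  of `G^{edges}`; Seiler LNP 159 Ch. 2), `HasUniqueInfiniteVolumeLimit`.
* DLR description (G02 `StatMech.Specification` / `gibbsMeasures` / `glueWith`): the Wilson
  boundary action `wilsonBoundaryAction ρ Λ`, the lattice Yang–Mills specification
  `ymSpecification ρ β` (product Haar measure on the edges of `Λ`, glued with the boundary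
  condition, tilted by `exp (-β S_Λ)`, Mathlib `Measure.tilted`), `ymGibbsMeasures`,
  `mem_ymGibbsMeasures_of_mem_infiniteVolumeLimitPoints` (Seiler LNP 159 Ch. 2; Georgii 2011
  Def. 2.9); the record `isSpecification_ymSpecification` is **refuted as stated and deprecated**
  (see "Verdict clean-up" below). The locality fact
  `isCylinder_wilsonBoundaryAction` (finite range of `S_Λ`) is discharged in-file by
  `isCylinder_wilsonBoundaryAction_holds` (section `Proofs`, via `isCylinder_plaquetteObs`).
* Observables and thermodynamics: `plaquetteObs`, `plaquetteCorr`, `plaquetteCorrFn` (the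
  plaquette–plaquette correlation `f_β(x)` of Chatterjee's Problem 5.1 = cqft.S28),
  `torusLogPartition`, `freeEnergyDensity`, `HasFreeEnergyDensity` (Chatterjee, JFA 281 (2016),
  arXiv:1602.01222, Thm. 1.1 = cqft.S17).

## Design choices

* Namespaces: this file lives in `Literature.AQFT`, `open`s `Literature.StatMech` (so `Site d` is `ℤ^d`) and
  qualifies every Wave 0 name as `ConstructiveQFT.…` (`ConstructiveQFT.Site d L` is the torus).
  Per outline §0 the predicates on `LGConfig` and its measures carry the prefix `Zd`
  (`IsZdGaugeInvariant`, `IsZdTranslationInvariant`) to avoid clashes with Wave 0's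
  `ConstructiveQFT.IsGaugeInvariant` and G02's `StatMech.IsTranslationInvariantMeasure`; the
  unprefixed `configShift` here shadows `StatMech.configShift` (translations of `Site d → S`)
  inside `Literature.AQFT` and is the same construction (`MeasurableEquiv.arrowCongr'`) on edges.
* Torus sizes are written `L + 1` in limits so that Wave 0's `[NeZero L]` is automatic.
* Plaquette observables take the base point and the two directions `(x i j)` as separate
  arguments (as Wave 0's `plaquetteHolonomy` and A10's `rectExpectation μ χ 0 1 R T` do), so that
  the `(0, 1)`-plane correlation function `plaquetteCorrFn` only needs `[NeZero d]`; for `i = j`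
  the holonomy is the junk value `1`.
* 't Hooft scaling (cqft.S16, Shen–Zhu–Zhu CMP 400 (2023)): the action `N β Re ∑ₚ tr Q_p` is the
  Wilson action at inverse coupling `N β`, i.e. the reparametrisation `β ↦ N * β` of
  `ymSpecification ρ β` / `wilsonMeasure ρ β`; no separate definition is introduced.
* Junk values: `Measure.tilted` is `0` when the normaliser is `0` or `∞` (Mathlib);
  `freeEnergyDensity` is a `limUnder` (junk if the limit does not exist) paired with
  `HasFreeEnergyDensity`; Bochner integrals are `0` for non-integrable integrands.
* Several sorried theorems assume `[SecondCountableTopology G]` (true for closed subgroups of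
  `U(N)`): it makes the product σ-algebra on `LGConfig d G` the Borel σ-algebra of the (compact)
  product topology, which the measurability of holonomies and the Riesz–Markov/Prokhorov
  construction of limit points use.

## Verdict clean-up (2026-08-15)

* `isSpecification_ymSpecification` — **refuted as stated, deprecated.** It renders "the lattice
  Yang–Mills kernels `ymSpecification ρ β` form a specification" (Seiler LNP 159 Ch. 2; Georgii 2011,
  Def. 2.9 with Prop. 2.5) for *every* compact second-countable `[BorelSpace G]` group, without the
  Hausdorff hypothesis `[T2Space G]` that its sibling facts `infiniteVolumeLimitPoints_nonempty` and
  `mem_ymGibbsMeasures_of_mem_infiniteVolumeLimitPoints` carry and that the sources have (the gauge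
  group is "a closed subgroup of the group of unitary matrices of some order `N`", Chatterjee
  arXiv:1803.01950 §2). For a non-`T₀` group the Borel σ-algebra does not separate inseparable points and
  the a.e.-properness axiom `IsSpecification.proper` fails. Kernel-checked refutation (kept):
  `Literature.MathematicalPhysics.QuantumLattice.not_isSpecification_ymSpecification_indiscrete`
  (`LatticeGaugeDLRSpecificationProofs.lean`, p38202: `d = 1`, `G = IndiscreteZ2`, `ρ = 1`), via
  `Literature.MathematicalPhysics.QuantumFieldTheory.not_isSpecification_ymSpecification_of_indiscrete`
  (`LatticeGaugeShenZhuZhuProofs.lean`). Corrected statement: the named fact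
  `Literature.MathematicalPhysics.QuantumLattice.isSpecification_ymSpecification_t2` (the same
  statement with `[T2Space G]`), discharged by `isSpecification_ymSpecification_t2_holds`
  (`LatticeGaugeDLRSpecificationProofs.lean`) from the theorem
  `Literature.MathematicalPhysics.QuantumFieldTheory.isSpecification_ymSpecification_of_t2Space`.
  Both live downstream of this file and are not re-declared here; the `def` is kept, statement
  byte-for-byte, only because its refutation names it, and carries `@[deprecated]`.

## Mathlib status

Mathlib (pinned) has no lattice gauge theory (grep for `plaquette`, `lattice gauge`, `Wilson`
finds nothing). Anchors used verbatim: `DependsOn`, `Measure.pi`, `Measure.tilted`,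
`Measure.map`, `MeasurableEquiv.arrowCongr'`, `Equiv.prodCongr`, `Filter.limUnder`,
`MeasureTheory.IsProbabilityMeasure`.

## References

* E. Seiler, *Gauge Theories as a Problem of Constructive Quantum Field Theory and Statistical
  Mechanics*, LNP 159 (Springer 1982), Ch. 1 (lattice gauge theories, Wilson action, gauge
  invariance), Ch. 2 (infinite-volume limit, DLR equations, free energy).
* S. Chatterjee, *Yang–Mills for probabilists*, arXiv:1803.01950, §2 (lattice gauge theories,
  infinite-volume Gibbs measures by compactness), §3 (Wilson loops, correlations), Problem 5.1.
* S. Chatterjee, JFA 281 (2016), arXiv:1602.01222, Thm. 1.1 (free energy of lattice gauge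
  theories).
* H.-O. Georgii, *Gibbs Measures and Phase Transitions* (2011), Def. 1.23, Def. 2.9, Thm. 4.17.
-/

noncomputable section

open MeasureTheory Filter Topology Complex Finset
open Literature.Probability.LatticeModels

namespace Literature.MathematicalPhysics.QuantumLattice

/-! ### Edges, plaquettes and configurations on `ℤ^d` -/

/-- Positively oriented edges of `ℤ^d`: `(x, i)` is the edge from `x` to `x + eᵢ`
(Seiler LNP 159 Ch. 1; Chatterjee arXiv:1803.01950 §2). [cite: arXiv180301950] -/
abbrev ZdEdge (d : ℕ) : Type := Site d × Fin d

/-- Plaquettes of `ℤ^d`: `(x, ⟨(i, j), i < j⟩)` is the unit square at `x` spanned by `eᵢ, eⱼ`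
(Chatterjee arXiv:1803.01950 §2). [cite: arXiv180301950] -/
abbrev ZdPlaquette (d : ℕ) : Type := Site d × {p : Fin d × Fin d // p.1 < p.2}

/-- Lattice gauge configurations on `ℤ^d`: a group element on every positively oriented edge;
the reversed edge carries the inverse (Wilson 1974; Seiler LNP 159 Ch. 1). [cite: Wilson1974] -/
abbrev LGConfig (d : ℕ) (G : Type*) : Type _ := ZdEdge d → G

variable {d N : ℕ} {G : Type*} [Group G]

/-- Plaquette holonomy on `ℤ^d`, `U_p = U(x,i) U(x+eᵢ,j) U(x+eⱼ,i)⁻¹ U(x,j)⁻¹`, around the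
plaquette at `x` in the `(i, j)` plane; the same formula as Wave 0's
`ConstructiveQFT.plaquetteHolonomy` with the torus shift replaced by `x + eᵢ` in `ℤ^d`
(`= Site.shift (Pi.single i 1) x`) (Wilson 1974; Chatterjee arXiv:1803.01950 §2). For `i = j`
this is the junk value `1`. [cite: Wilson1974] -/
def plaquetteHolonomyZd (U : LGConfig d G) (x : Site d) (i j : Fin d) : G :=
  U (x, i) * U (x + Pi.single i 1, j) * (U (x + Pi.single j 1, i))⁻¹ * (U (x, j))⁻¹

/-- The four (positively oriented) edges of the plaquette `p = (x, i, j)`: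
`(x, i), (x + eᵢ, j), (x + eⱼ, i), (x, j)` (Chatterjee arXiv:1803.01950 §2). [cite: arXiv180301950] -/
def plaquetteEdges (p : ZdPlaquette d) : Finset (ZdEdge d) :=
  {(p.1, p.2.1.1), (p.1 + Pi.single p.2.1.1 1, p.2.1.2), (p.1 + Pi.single p.2.1.2 1, p.2.1.1),
    (p.1, p.2.1.2)}

/-- The finite set of plaquettes having at least one edge in the finite edge set `Λ`
(the plaquettes entering the DLR kernel of `Λ`; Seiler LNP 159 Ch. 2). Constructed as an
explicit finite image: a plaquette containing the edge `(x, i)` has base point `x` or `x - eⱼ`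
for some `j`, so we range over these base points and all planes and filter. [folklore] -/
def plaquettesTouching (Λ : Finset (ZdEdge d)) : Finset (ZdPlaquette d) :=
  ((Λ.image Prod.fst ∪ (Λ ×ˢ (univ : Finset (Fin d))).image
      fun ej => ej.1.1 - Pi.single ej.2 1) ×ˢ univ).filter
    fun p => (plaquetteEdges p ∩ Λ).Nonempty

/-- Characterisation of `plaquettesTouching`: `p` touches `Λ` iff one of its four edges lies in
`Λ` (Seiler LNP 159 Ch. 2). [folklore] -/
theorem mem_plaquettesTouching_iff {Λ : Finset (ZdEdge d)} {p : ZdPlaquette d} :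
    p ∈ plaquettesTouching Λ ↔ (plaquetteEdges p ∩ Λ).Nonempty := by
  refine ⟨fun h => (mem_filter.1 h).2,
    fun h => mem_filter.2 ⟨mem_product.2 ⟨?_, mem_univ _⟩, h⟩⟩
  obtain ⟨e, he⟩ := h
  obtain ⟨he1, he2⟩ := mem_inter.1 he
  simp only [plaquetteEdges, mem_insert, mem_singleton] at he1
  rw [mem_union, mem_image, mem_image]
  rcases he1 with rfl | rfl | rfl | rfl
  · exact Or.inl ⟨_, he2, rfl⟩
  · exact Or.inr ⟨(_, p.2.1.1), mem_product.2 ⟨he2, mem_univ _⟩, by simp⟩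
  · exact Or.inr ⟨(_, p.2.1.2), mem_product.2 ⟨he2, mem_univ _⟩, by simp⟩
  · exact Or.inl ⟨_, he2, rfl⟩

/-! ### Gauge transformations -/

/-- Gauge transformation on `ℤ^d` by `g : ℤ^d → G`: `U(x,i) ↦ g(x) U(x,i) g(x+eᵢ)⁻¹`
(Seiler LNP 159 Ch. 1). [folklore] -/
def gaugeTransformZd (g : Site d → G) (U : LGConfig d G) : LGConfig d G :=
  fun e => g e.1 * U e * (g (e.1 + Pi.single e.2 1))⁻¹

/-- A gauge-invariant observable on `ℤ^d`: invariant under all gauge transformations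
`gaugeTransformZd g` (Seiler LNP 159 Ch. 1). The `Zd` prefix distinguishes it from Wave 0's torus
version `ConstructiveQFT.IsGaugeInvariant` (outline §0). [folklore] -/
def IsZdGaugeInvariant {α : Type*} (F : LGConfig d G → α) : Prop :=
  ∀ (g : Site d → G) (U : LGConfig d G), F (gaugeTransformZd g U) = F U

/-- The plaquette holonomy transforms by conjugation at the base point,
`(U^g)_p = g(x) U_p g(x)⁻¹` (Seiler LNP 159 Ch. 1). [folklore] -/
theorem plaquetteHolonomyZd_gaugeTransformZd (g : Site d → G) (U : LGConfig d G) (x : Site d)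
    (i j : Fin d) :
    plaquetteHolonomyZd (gaugeTransformZd g U) x i j =
      g x * plaquetteHolonomyZd U x i j * (g x)⁻¹ := by
  have hshift : x + Pi.single i (1 : ℤ) + Pi.single j 1 = x + Pi.single j 1 + Pi.single i 1 :=
    add_right_comm _ _ _
  simp only [plaquetteHolonomyZd, gaugeTransformZd, hshift, mul_inv_rev, inv_inv]
  group

/-! ### Plaquette observables -/

section Observables

variable (ρ : G →* Matrix (Fin N) (Fin N) ℂ)

/-- The plaquette observable `Re tr ρ(U_p)` of the plaquette at `x` in the `(i, j)` plane
(Chatterjee arXiv:1803.01950 §2 and Problem 5.1; Seiler LNP 159 Ch. 1). [cite: arXiv180301950] -/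
def plaquetteObs (x : Site d) (i j : Fin d) (U : LGConfig d G) : ℝ :=
  (ρ (plaquetteHolonomyZd U x i j)).trace.re

/-- The plaquette observable is gauge invariant (cyclicity of the trace; Seiler LNP 159 Ch. 1). [folklore] -/
theorem isZdGaugeInvariant_plaquetteObs (x : Site d) (i j : Fin d) :
    IsZdGaugeInvariant (plaquetteObs (G := G) ρ x i j) := fun g U => by
  simp only [plaquetteObs, plaquetteHolonomyZd_gaugeTransformZd]
  rw [map_mul, map_mul, Matrix.trace_mul_cycle, ← map_mul, inv_mul_cancel, map_one, one_mul]

/-- The plaquette observable is bounded by `N` when `ρ` is unitary (each eigenvalue of `ρ(g)`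
has modulus `1`) (Chatterjee arXiv:1803.01950 §2). [cite: arXiv180301950] -/
def abs_plaquetteObs_le : Prop :=
  ∀ (hρu : ∀ g, ρ g ∈ Matrix.unitaryGroup (Fin N) ℂ) (x : Site d) (i j : Fin d) (U : LGConfig d G),
    |plaquetteObs ρ x i j U| ≤ N

end Observables

/-! ### Translations -/

/-- Translation of edges by `v ∈ ℤ^d`, `(x, i) ↦ (x + v, i)`, as a bijection
(G02 `Site.shift v` on the base point) (Seiler LNP 159 Ch. 2, translation invariance). [folklore] -/
def edgeShift (v : Site d) : ZdEdge d ≃ ZdEdge d :=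
  (Site.shift v).prodCongr (Equiv.refl (Fin d))

/-- `edgeShift v (x, i) = (x + v, i)`. [folklore] -/
@[simp] theorem edgeShift_apply (v : Site d) (e : ZdEdge d) : edgeShift v e = (e.1 + v, e.2) := rfl

/-- `(edgeShift v)⁻¹ (x, i) = (x - v, i)`. [folklore] -/
@[simp] theorem edgeShift_symm_apply (v : Site d) (e : ZdEdge d) :
    (edgeShift v).symm e = (e.1 - v, e.2) := by
  simp only [edgeShift, Equiv.prodCongr_symm, Equiv.refl_symm, Equiv.prodCongr_apply, Prod.map,
    Site.shift_symm_apply, Equiv.refl_apply]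

section Shift

omit [Group G]
variable [MeasurableSpace G]

/-- Translation of gauge configurations on `ℤ^d` by `v`: `(configShift v U) (x, i) = U (x - v, i)`,
as a measurable equivalence of `LGConfig d G` (Mathlib `MeasurableEquiv.arrowCongr'` applied to
`edgeShift v`; the same construction as G02 `StatMech.configShift` on `Site d → S`, which this
declaration shadows inside `Literature.AQFT`) (Seiler LNP 159 Ch. 2; Georgii 2011 (5.3)). [cite: Georgii2011, (5.3] -/
def configShift (v : Site d) : LGConfig d G ≃ᵐ LGConfig d G :=
  MeasurableEquiv.arrowCongr' (edgeShift v) (MeasurableEquiv.refl G)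

/-- `configShift v U e = U ((edgeShift v)⁻¹ e) = U (x - v, i)` (Georgii 2011 (5.3)). [cite: Georgii2011, (5.3] -/
@[simp] theorem configShift_apply (v : Site d) (U : LGConfig d G) (e : ZdEdge d) :
    configShift v U e = U (e.1 - v, e.2) := by
  change U ((edgeShift v).symm e) = _
  rw [edgeShift_symm_apply]

/-- `μ` is translation invariant: `μ ∘ θ_v⁻¹ = μ` for every `v ∈ ℤ^d`
(Seiler LNP 159 Ch. 2; Georgii 2011 (5.4)). The `Zd` prefix is prescribed by outline §0. [cite: Georgii2011, (5.4] -/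
def IsZdTranslationInvariant (μ : Measure (LGConfig d G)) : Prop :=
  ∀ v : Site d, μ.map (configShift v) = μ

end Shift

/-! ### Cylinder (local) observables -/

/-- `F` is a cylinder observable with (edge) support `S`: `F U` depends only on the restriction
`U|_S` (Mathlib `DependsOn`) (Seiler LNP 159 Ch. 2; Chatterjee arXiv:1803.01950 §2, "local
observables"). [cite: arXiv180301950] -/
def IsCylinder {α : Type*} (F : LGConfig d G → α) (S : Finset (ZdEdge d)) : Prop :=
  DependsOn F (↑S : Set (ZdEdge d))

/-- A local observable: a cylinder observable for some finite edge set
(Seiler LNP 159 Ch. 2). [folklore] -/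
def IsLocalObservable {α : Type*} (F : LGConfig d G → α) : Prop :=
  ∃ S : Finset (ZdEdge d), IsCylinder F S

/-! ### Comparison with the torus theory of Wave 0 -/

/-- The edge of the discrete torus `(ℤ/Lℤ)^d` below the edge `(x, i)` of `ℤ^d`: reduce the base
point mod `L` (G02 `Torus.proj`; `ConstructiveQFT.Site d L = TorusSite d L` definitionally)
(Seiler LNP 159 Ch. 2, periodic boundary conditions). [folklore] -/
def torusEdge (L : ℕ) (e : ZdEdge d) : QuantumFieldTheory.Edge d L :=
  (Torus.proj L e.1, e.2)

/-- Lift a torus configuration to the `L`-periodic configuration on `ℤ^d`,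
`(torusLift L U) e = U (e mod L)` (Seiler LNP 159 Ch. 2). [folklore] -/
def torusLift (L : ℕ) (U : QuantumFieldTheory.GaugeConfig d L G) : LGConfig d G :=
  U ∘ torusEdge L

/-- Restrict an observable of the infinite lattice to torus configurations (through the periodic
lift): `toTorusObservable L F = F ∘ torusLift L`. For a cylinder observable whose support fits
in a fundamental domain this is "the same observable on the torus" (Seiler LNP 159 Ch. 2). [folklore] -/
def toTorusObservable {α : Type*} (L : ℕ) (F : LGConfig d G → α) :
    QuantumFieldTheory.GaugeConfig d L G → α :=
  F ∘ torusLift L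

omit [Group G] in
/-- `toTorusObservable` unfolded (Seiler LNP 159 Ch. 2). [folklore] -/
@[simp] theorem toTorusObservable_apply {α : Type*} (L : ℕ) (F : LGConfig d G → α)
    (U : QuantumFieldTheory.GaugeConfig d L G) :
    toTorusObservable L F U = F (torusLift L U) := rfl

/-! ### Infinite-volume limits along tori -/

section Limits

variable [TopologicalSpace G] [IsTopologicalGroup G] [CompactSpace G] [MeasurableSpace G]
  [BorelSpace G] (ρ : G →* Matrix (Fin N) (Fin N) ℂ)

/-- `μ` is the infinite-volume limit of the torus Wilson states `μ_{Λ_{L_k + 1}, β}` along the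
sequence of torus sizes `L_k + 1`: `μ` is a probability measure on `LGConfig d G` and
`⟨F ∘ torusLift⟩_{Λ_{L_k+1}, β} → ∫ F dμ` for every bounded continuous cylinder observable `F`
(Seiler LNP 159 Ch. 2; Chatterjee arXiv:1803.01950 §2). Torus sizes are `L_k + 1` so that
Wave 0's `[NeZero _]` is automatic. [cite: arXiv180301950] -/
def IsInfiniteVolumeLimitAlong (β : ℝ) (L : ℕ → ℕ) (μ : Measure (LGConfig d G)) : Prop :=
  IsProbabilityMeasure μ ∧
    ∀ (F : LGConfig d G → ℝ) (S : Finset (ZdEdge d)), IsCylinder F S → Continuous F →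
      (∃ C, ∀ U, |F U| ≤ C) →
        Tendsto (fun k : ℕ =>
          QuantumFieldTheory.wilsonExpectation (L := L k + 1) ρ β (toTorusObservable (L k + 1) F))
          atTop (𝓝 (∫ U, F U ∂μ))

/-- `μ` is *the* infinite-volume limit of the torus Wilson states: the full sequence
`μ_{Λ_{L+1}, β}`, `L → ∞`, converges to `μ` on bounded continuous cylinder observables
(Seiler LNP 159 Ch. 2; Osterwalder–Seiler 1978 §4). [cite: OsterwalderSeiler1978, §4] -/
def IsInfiniteVolumeLimit (β : ℝ) (μ : Measure (LGConfig d G)) : Prop :=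
  IsInfiniteVolumeLimitAlong ρ β id μ

/-- The set of infinite-volume limit points at inverse coupling `β`: probability measures on
`LGConfig d G` arising as limits of the torus Wilson states along some subsequence of torus
sizes `L_k + 1 → ∞` (Seiler LNP 159 Ch. 2; Chatterjee arXiv:1803.01950 §2). [cite: arXiv180301950] -/
def infiniteVolumeLimitPoints (β : ℝ) : Set (Measure (LGConfig d G)) :=
  {μ | ∃ L : ℕ → ℕ, StrictMono L ∧ IsInfiniteVolumeLimitAlong ρ β L μ}

/-- The infinite-volume limit (of the full sequence) is a limit point (Seiler LNP 159 Ch. 2). [folklore] -/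
theorem IsInfiniteVolumeLimit.mem_infiniteVolumeLimitPoints {β : ℝ} {μ : Measure (LGConfig d G)}
    (h : IsInfiniteVolumeLimit ρ β μ) : μ ∈ infiniteVolumeLimitPoints ρ β :=
  ⟨id, strictMono_id, h⟩

/-- Existence of infinite-volume limit points: for a continuous representation `ρ` of the
compact (second countable) gauge group `G`, the torus Wilson states have a subsequential limit,
by compactness of `G^{edges}` (Riesz–Markov / Prokhorov) (Seiler LNP 159 Ch. 2; Chatterjee
arXiv:1803.01950 §2). This makes statements quantifying over `infiniteVolumeLimitPoints`
visibly non-vacuous (outline A-D3, F4). [cite: arXiv180301950] -/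
def infiniteVolumeLimitPoints_nonempty : Prop :=
  ∀ [T2Space G] [SecondCountableTopology G] (hρ : Continuous ρ) (β : ℝ),
    (infiniteVolumeLimitPoints (d := d) ρ β).Nonempty

/-- The infinite-volume limit is unique: the full sequence of torus states converges to some
`μ`, and `μ` is the only subsequential limit point (Osterwalder–Seiler 1978 §4, strong coupling;
Seiler LNP 159 Ch. 2). [cite: OsterwalderSeiler1978, §4  strong coupling] -/
def HasUniqueInfiniteVolumeLimit (β : ℝ) : Prop :=
  ∃ μ : Measure (LGConfig d G), IsInfiniteVolumeLimit ρ β μ ∧ infiniteVolumeLimitPoints ρ β = {μ}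

end Limits

/-! ### The DLR description: the lattice Yang–Mills specification -/

section DLR

variable (ρ : G →* Matrix (Fin N) (Fin N) ℂ)

/-- The Wilson action of the finite edge set `Λ` *with boundary terms*:
`S_Λ(U) = ∑_{p : p ∩ Λ ≠ ∅} (N - Re tr ρ(U_p))`, summed over all plaquettes with at least one
edge in `Λ` (Seiler LNP 159 Ch. 2, (2.1); Chatterjee arXiv:1803.01950 §2). [cite: arXiv180301950] -/
def wilsonBoundaryAction (Λ : Finset (ZdEdge d)) (U : LGConfig d G) : ℝ :=
  ∑ p ∈ plaquettesTouching Λ, ((N : ℝ) - plaquetteObs ρ p.1 p.2.1.1 p.2.1.2 U)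

/-- The boundary Wilson action is gauge invariant (Seiler LNP 159 Ch. 1–2). [folklore] -/
theorem wilsonBoundaryAction_gaugeTransformZd (Λ : Finset (ZdEdge d)) (g : Site d → G)
    (U : LGConfig d G) :
    wilsonBoundaryAction ρ Λ (gaugeTransformZd g U) = wilsonBoundaryAction ρ Λ U := by
  simp only [wilsonBoundaryAction, isZdGaugeInvariant_plaquetteObs ρ _ _ _ g U]

/-- The boundary Wilson action of `Λ` depends only on the edges of plaquettes touching `Λ`
(Seiler LNP 159 Ch. 2). [cite: SeilerLNP1982, Ch. 2 (lattice gauge theories: locality and gauge covariance of the Wilson specification)] -/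
def isCylinder_wilsonBoundaryAction : Prop :=
  ∀ (Λ : Finset (ZdEdge d)),
    IsCylinder (wilsonBoundaryAction (G := G) ρ Λ)
      ((plaquettesTouching Λ).biUnion plaquetteEdges)

variable [TopologicalSpace G] [IsTopologicalGroup G] [CompactSpace G] [MeasurableSpace G]
  [BorelSpace G]

/-- The lattice Yang–Mills (Wilson) specification on `ℤ^d` at inverse coupling `β`:
`γ_Λ(dU | η) = Z_Λ(η)⁻¹ exp(-β S_Λ(U)) ∏_{e ∈ Λ} dHaar(U_e) ⊗ δ_{η_{Λᶜ}}`, i.e. the product Haar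
measure on the edges of `Λ`, glued with the boundary condition `η` off `Λ` (G02 `glueWith`) and
tilted by `-β` times the boundary Wilson action (Mathlib `Measure.tilted`; junk value `0` if the
normaliser is `0` or `∞`, which does not happen for continuous `ρ`, see
`isSpecification_ymSpecification_t2` in `LatticeGaugeDLRSpecificationProofs.lean`) (Seiler LNP 159
Ch. 2, DLR equations; Georgii 2011 Def. 2.9). [cite: Georgii2011, Def. 2.9] -/
def ymSpecification (β : ℝ) : Specification (ZdEdge d) G :=
  fun Λ η => ((Measure.pi fun _ : ↥Λ => QuantumFieldTheory.haarProbability G).map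
    (glueWith Λ · η)).tilted fun U => -β * wilsonBoundaryAction ρ Λ U

/-- The set `𝒢(β)` of infinite-volume lattice Yang–Mills Gibbs states: DLR measures of
`ymSpecification ρ β` (G02 `gibbsMeasures`) (Seiler LNP 159 Ch. 2; Georgii 2011 Def. 1.23). [cite: Georgii2011, Def. 1.23] -/
def ymGibbsMeasures (β : ℝ) : Set (Measure (LGConfig d G)) :=
  gibbsMeasures (ymSpecification ρ β)

/-- Membership in `ymGibbsMeasures` is the DLR condition (Georgii 2011 Def. 1.23). [cite: Georgii2011, Def. 1.23] -/
@[simp] theorem mem_ymGibbsMeasures_iff (β : ℝ) (μ : Measure (LGConfig d G)) :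
    μ ∈ ymGibbsMeasures ρ β ↔ IsGibbsMeasure (ymSpecification ρ β) μ := Iff.rfl

/-- **Refuted as stated — deprecated (verdict clean-up 2026-08-15); kept, statement byte-for-byte,
only because its refutation names it.** The record was meant to say: for a continuous
representation `ρ` of the compact (second countable) group `G`, the lattice Yang–Mills kernels
form a specification in Georgii's sense — probability (the tilting density `exp(-β S_Λ)` is
bounded, continuous and positive), `𝓕_{Λᶜ}`-measurability, properness, consistency — with no
sign condition on `β` (Seiler LNP 159 Ch. 2; Georgii 2011 Def. 2.9 with Prop. 2.5). As elaborated
it quantifies over every compact second-countable `[BorelSpace G]` group and **omits the Hausdorff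
hypothesis `[T2Space G]`** of its sibling facts `infiniteVolumeLimitPoints_nonempty` and
`mem_ymGibbsMeasures_of_mem_infiniteVolumeLimitPoints`, which the sources have (the gauge group is
"a closed subgroup of the group of unitary matrices of some order `N`", Chatterjee
arXiv:1803.01950 §2), hence compact metrisable. For a non-`T₀` group the Borel σ-algebra is
trivial along inseparable fibres and the a.e.-properness axiom
`IsSpecification.proper` fails for `d ≥ 1` (the exceptional set `{σ | ∃ e ∉ Λ, σ e ≠ η e}` is
non-measurable, of outer measure `1`).
**Refutation (kernel-checked, kept):**
`Literature.MathematicalPhysics.QuantumLattice.not_isSpecification_ymSpecification_indiscrete`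
(`LatticeGaugeDLRSpecificationProofs.lean`, p38202: `d = 1`, `G = IndiscreteZ2` — `ℤ/2` with the
indiscrete topology and its trivial Borel σ-algebra — and the trivial representation `ρ = 1`), via
`Literature.MathematicalPhysics.QuantumFieldTheory.not_isSpecification_ymSpecification_of_indiscrete`
(`LatticeGaugeShenZhuZhuProofs.lean`). **Corrected statement — use instead:** the named fact
`Literature.MathematicalPhysics.QuantumLattice.isSpecification_ymSpecification_t2` (this statement
with `[T2Space G]` added, closed over `d, N, G, ρ`; same source and locator), discharged by
`isSpecification_ymSpecification_t2_holds` (`LatticeGaugeDLRSpecificationProofs.lean`), or directly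
the theorem
`Literature.MathematicalPhysics.QuantumFieldTheory.isSpecification_ymSpecification_of_t2Space`
(`LatticeGaugeShenZhuZhuProofs.lean`, hypotheses `[T2Space G] [SecondCountableTopology G]`,
`Continuous ρ`). Neither is re-declared here (both files import this one); no
`isSpecification_ymSpecification_holds` can exist. [cite: Georgii2011, Def. 2.9 with Prop. 2.5] -/
@[deprecated "refuted as stated (no [T2Space G] hypothesis): see \
  Literature.MathematicalPhysics.QuantumLattice.not_isSpecification_ymSpecification_indiscrete \
  (LatticeGaugeDLRSpecificationProofs.lean); corrected statement: \
  Literature.MathematicalPhysics.QuantumLattice.isSpecification_ymSpecification_t2 \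
  (proved: isSpecification_ymSpecification_t2_holds), or the theorem \
  Literature.MathematicalPhysics.QuantumFieldTheory.isSpecification_ymSpecification_of_t2Space"
  (since := "2026-08-15")]
def isSpecification_ymSpecification : Prop :=
  ∀ [SecondCountableTopology G] (hρ : Continuous ρ) (β : ℝ),
    IsSpecification (ymSpecification (d := d) ρ β)

/-- Infinite-volume limits of torus Wilson states are DLR states: every
`μ ∈ infiniteVolumeLimitPoints ρ β` satisfies the DLR equations for `ymSpecification ρ β`
(the torus states satisfy the local DLR equations for volumes fitting in a fundamental domain,
and the specification is Feller since `G` is compact and the interaction has finite range)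
(Seiler LNP 159 Ch. 2; Georgii 2011 Thm. 4.17). [cite: Georgii2011, Thm. 4.17] -/
def mem_ymGibbsMeasures_of_mem_infiniteVolumeLimitPoints : Prop :=
  ∀ [T2Space G] [SecondCountableTopology G] (hρ : Continuous ρ) {β : ℝ} {μ : Measure (LGConfig d G)} (hμ : μ ∈ infiniteVolumeLimitPoints ρ β),
    μ ∈ ymGibbsMeasures ρ β

/-- The lattice Yang–Mills specification is gauge covariant: pushing `γ_Λ(· | η)` forward under
a gauge transformation gives `γ_Λ(· | η^g)` (Haar measure is bi-invariant and `S_Λ` is gauge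
invariant) (Seiler LNP 159 Ch. 2). [cite: SeilerLNP1982, Ch. 2 (lattice gauge theories: locality and gauge covariance of the Wilson specification)] -/
def ymSpecification_map_gaugeTransformZd : Prop :=
  ∀ [SecondCountableTopology G] (hρ : Continuous ρ) (β : ℝ) (Λ : Finset (ZdEdge d)) (η : LGConfig d G) (g : Site d → G),
    (ymSpecification ρ β Λ η).map (gaugeTransformZd g) =
      ymSpecification ρ β Λ (gaugeTransformZd g η)

end DLR

/-! ### Plaquette correlations -/

section Correlations

variable (ρ : G →* Matrix (Fin N) (Fin N) ℂ)

variable [MeasurableSpace G]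

/-- The (truncated) plaquette–plaquette correlation
`Cov_μ(Re tr ρ(U_p), Re tr ρ(U_{p'})) = ∫ O_p O_{p'} dμ - ∫ O_p dμ ∫ O_{p'} dμ` in the state `μ`
(Chatterjee arXiv:1803.01950 §3 and Problem 5.1). Bochner integrals (junk `0` if not
integrable; the observables are bounded for unitary `ρ`). [cite: arXiv180301950] -/
def plaquetteCorr (μ : Measure (LGConfig d G)) (x : Site d) (i j : Fin d) (y : Site d)
    (k l : Fin d) : ℝ :=
  (∫ U, plaquetteObs ρ x i j U * plaquetteObs ρ y k l U ∂μ) -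
    (∫ U, plaquetteObs ρ x i j U ∂μ) * ∫ U, plaquetteObs ρ y k l U ∂μ

/-- The plaquette–plaquette correlation function `f_β(x)` of Chatterjee's Problem 5.1
(cqft.S28): the truncated correlation in the state `μ` of the plaquette at the origin and the
plaquette at `x`, both in the `(0, 1)` coordinate plane (Chatterjee arXiv:1803.01950
Problem 5.1). Requires `d ≥ 1` for the indices; meaningful for `d ≥ 2`. [cite: arXiv180301950] -/
def plaquetteCorrFn [NeZero d] (μ : Measure (LGConfig d G)) (x : Site d) : ℝ :=
  plaquetteCorr ρ μ 0 0 1 x 0 1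

end Correlations

/-! ### Free energy -/

section FreeEnergy

variable [TopologicalSpace G] [IsTopologicalGroup G] [CompactSpace G] [MeasurableSpace G]
  [BorelSpace G] (ρ : G →* Matrix (Fin N) (Fin N) ℂ)

variable (d) in
/-- The logarithm of the torus partition function, `log Z_{Λ_L, β}` with
`Z = ∫ exp(-β S(U)) ∏ₑ dU_e` Wave 0's `ConstructiveQFT.partitionFunction` (an `ℝ≥0∞`, converted
with `toReal`; `Real.log` of `0`/junk if `Z ∈ {0, ∞}`, which does not happen for continuous `ρ`)
(Seiler LNP 159 Ch. 2; Chatterjee arXiv:1602.01222 §1). [cite: arXiv160201222] -/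
def torusLogPartition (β : ℝ) (L : ℕ) [NeZero L] : ℝ :=
  Real.log (QuantumFieldTheory.partitionFunction (d := d) (L := L) ρ β).toReal

variable (d) in
/-- `f` is the free energy density (pressure) per site at inverse coupling `β`:
`|Λ_L|⁻¹ log Z_{Λ_L, β} → f` as `L → ∞` along the tori `Λ_L = (ℤ/Lℤ)^d`, `|Λ_L| = L^d`
(Chatterjee, JFA 281 (2016), arXiv:1602.01222, Thm. 1.1; Seiler LNP 159 Ch. 2). Torus sizes
are written `L + 1`. [cite: arXiv160201222] -/
def HasFreeEnergyDensity (β f : ℝ) : Prop :=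
  Tendsto (fun L : ℕ => (((L + 1 : ℕ) : ℝ) ^ d)⁻¹ * torusLogPartition d ρ β (L + 1)) atTop (𝓝 f)

variable (d) in
/-- The free energy density per site `f(β) = lim_{L → ∞} |Λ_L|⁻¹ log Z_{Λ_L, β}` along tori, as a
junk-valued `limUnder` (meaningful iff `HasFreeEnergyDensity ρ d β f` for some `f`, see
`hasFreeEnergyDensity_freeEnergyDensity`) (Chatterjee arXiv:1602.01222 Thm. 1.1; Seiler LNP 159
Ch. 2). Under 't Hooft scaling (cqft.S16) one evaluates at `β := N * β'`. [cite: arXiv160201222] -/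
def freeEnergyDensity (β : ℝ) : ℝ :=
  limUnder atTop fun L : ℕ => (((L + 1 : ℕ) : ℝ) ^ d)⁻¹ * torusLogPartition d ρ β (L + 1)

/-- If the free energy density exists it is `freeEnergyDensity` (`Tendsto.limUnder_eq`). [folklore] -/
theorem HasFreeEnergyDensity.freeEnergyDensity_eq {β f : ℝ}
    (h : HasFreeEnergyDensity d ρ β f) : freeEnergyDensity d ρ β = f :=
  Tendsto.limUnder_eq h

/-- If some free energy density exists, `freeEnergyDensity` has the defining property. [folklore] -/
theorem hasFreeEnergyDensity_freeEnergyDensity {β : ℝ} (h : ∃ f, HasFreeEnergyDensity d ρ β f) :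
    HasFreeEnergyDensity d ρ β (freeEnergyDensity d ρ β) := by
  obtain ⟨f, hf⟩ := h
  rwa [hf.freeEnergyDensity_eq]

/-- Existence of the free energy density of lattice gauge theory for a continuous
representation of a compact group, at every `β` (subadditivity / Chatterjee, JFA 281 (2016),
arXiv:1602.01222, Thm. 1.1 for tori in general dimension; Seiler LNP 159 Ch. 2). [cite: arXiv160201222] -/
def exists_hasFreeEnergyDensity : Prop :=
  ∀ [SecondCountableTopology G] (hρ : Continuous ρ) (β : ℝ),
    ∃ f, HasFreeEnergyDensity d ρ β f

end FreeEnergy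

/-! ### Proofs: locality of the boundary Wilson action -/

section Proofs

variable (ρ : G →* Matrix (Fin N) (Fin N) ℂ)

/-- Each plaquette observable `Re tr ρ(U_p)` is a cylinder observable supported on the four
edges of `p`: `U_p = U(x,i) U(x+eᵢ,j) U(x+eⱼ,i)⁻¹ U(x,j)⁻¹` reads `U` only on `plaquetteEdges p`
(Seiler LNP 159 Ch. 2; Chatterjee arXiv:1803.01950 §3, definition of `U_p`). [cite: SeilerLNP1982, Ch. 2 (lattice gauge theories: locality and gauge covariance of the Wilson specification)] -/
theorem isCylinder_plaquetteObs (p : ZdPlaquette d) :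
    IsCylinder (plaquetteObs (G := G) ρ p.1 p.2.1.1 p.2.1.2) (plaquetteEdges p) := by
  intro U V h
  simp only [plaquetteObs, plaquetteHolonomyZd]
  rw [h (p.1, p.2.1.1) (by simp [plaquetteEdges]),
    h (p.1 + Pi.single p.2.1.1 1, p.2.1.2) (by simp [plaquetteEdges]),
    h (p.1 + Pi.single p.2.1.2 1, p.2.1.1) (by simp [plaquetteEdges]),
    h (p.1, p.2.1.2) (by simp [plaquetteEdges])]

/-- **Locality of the boundary Wilson action** — discharge of the named fact
`isCylinder_wilsonBoundaryAction`: `S_Λ(U) = ∑_{p ∩ Λ ≠ ∅} (N - Re tr ρ(U_p))` is a finite sum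
of plaquette observables, each depending on `U` only through the four edges of its plaquette,
hence `S_Λ` depends on `U` only through `⋃_{p ∩ Λ ≠ ∅} edges(p)` (Seiler LNP 159 Ch. 2, the
Wilson action with boundary terms has finite range; Chatterjee arXiv:1803.01950 §3,
`S_Λ(U) := ∑_{p ∈ P(Λ)} Re tr(I - U_p)`). [cite: SeilerLNP1982, Ch. 2 (lattice gauge theories: locality and gauge covariance of the Wilson specification)] -/
theorem isCylinder_wilsonBoundaryAction_holds :
    isCylinder_wilsonBoundaryAction (d := d) (G := G) ρ := by
  intro Λ U V h
  refine Finset.sum_congr rfl fun p hp => ?_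
  rw [isCylinder_plaquetteObs ρ p fun e he => h e (Finset.mem_biUnion.2 ⟨p, hp, he⟩)]

end Proofs

/-! ### Proofs: boundedness of the plaquette observable -/

section PlaquetteBound

variable (ρ : G →* Matrix (Fin N) (Fin N) ℂ)

/-- **Boundedness of the plaquette observable** — discharge of the named fact
`abs_plaquetteObs_le`: if `ρ` takes values in the unitary group `U(N)` then
`|Re tr ρ(U_p)| ≤ N` for every plaquette `p` and every configuration `U`. Chatterjee
(arXiv:1803.01950) takes the gauge group to be a closed subgroup of `U(N)` (§2) and forms the
Wilson action from `Re tr(I - U_p)` with `U_p` the plaquette holonomy (§3, display after (3.1));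
the bound is the elementary estimate `|Re tr M| ≤ ‖tr M‖ ≤ ∑ₖ ‖M k k‖ ≤ N` for a unitary matrix
`M`, whose entries have modulus `≤ 1` (Mathlib `entry_norm_bound_of_unitary`).
[cite: arXiv180301950, §2–§3 (G ⊆ U(N); U_p and the Wilson action Re tr(I − U_p))] -/
theorem abs_plaquetteObs_le_holds : abs_plaquetteObs_le (d := d) (G := G) ρ := by
  intro hρu x i j U
  unfold plaquetteObs
  generalize hM : ρ (plaquetteHolonomyZd U x i j) = M
  have hMu : M ∈ Matrix.unitaryGroup (Fin N) ℂ := hM ▸ hρu _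
  calc |M.trace.re| ≤ ‖M.trace‖ := Complex.abs_re_le_norm _
    _ = ‖∑ k, M k k‖ := rfl
    _ ≤ ∑ k, ‖M k k‖ := norm_sum_le _ _
    _ ≤ ∑ _k : Fin N, (1 : ℝ) := Finset.sum_le_sum fun k _ => entry_norm_bound_of_unitary hMu k k
    _ = N := by simp

end PlaquetteBound

end Literature.MathematicalPhysics.QuantumLattice
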